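import HarnessLib
import HarnessLib.Audit
import Summits.PneNP.PneNP.Theses.PermanentDescent
import Summits.PneNP.PneNP.Theorems.PermanentDescentUniformizationUnderCollapse
import Literature.Computability.Complexity.CircuitEval

/-!
# Line `birth` (v4) — skeleton for the crux `CollapseMakesPermanentEasy` (stmt-PneNP-16142)

Route `PermanentDescent` (route-PneNP-PermanentDescent), crux (rank 2) `CollapseMakesPermanentEasy` =
"NO ALGORITHMICA WITHOUT COUNTICA": if `NP ⊆ P` (Cook–Karp classes over `{0,1}`) then the bit-graph
language `PermBits = {⟨s, bin i⟩ : |s| = n², bit i of perm(M_s) over ℕ is 1}` of the 0/1 permanent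
(row-major `M_s(a,b) = s[b + n·a]`) is in `P`.

THE LINE = the route's own foreseen split: NON-UNIFORM existence of small permanent circuits
(`stub_collapseShrinksPermanent` = item stmt-PneNP-16144, OPEN, load-bearing, held by the lead) + their UNIFORM
recovery (item stmt-PneNP-16145 `UniformizationUnderCollapse`).

History (lead prover-line-stmt-PneNP-16142-0, 2026-08-17). v1 (planner): two stubs. v2: the uniform half reshaped
into five machine-level / algebra stubs over `Theorems/PermanentDescentCollapseMakesPermanentEasyDefs.lean`
(p158877) with the seam `uniformization_of_stubs` proved in the skeleton. v3: all five stubs LANDED (p159717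
StubLaplace, p159719 StubSound, p159786 StubComplete, p159688 StubAnsValFP, p160055 StubCheckFP). v4 (this file):
the seam itself LANDED as `Theorems/PermanentDescentUniformizationUnderCollapse.lean` (p160687) — the route item
stmt-PneNP-16145 is CLOSED by `Summit.PneNP.PneNP.Theorems.uniformizationUnderCollapse_proof` — so the skeleton
imports it and keeps exactly ONE `sorry`: Stub 1. The crux is now formally EQUIVALENT to item 16144
(`Theorems/PermanentDescentCollapseShrinksPermanentIffCrux.lean`, p161634: `CollapseMakesPermanentEasy ↔
CollapseShrinksPermanent`, `→` by `P ⊆ P/poly`, `←` by the landed uniformization).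

Stub 1 is an open problem ("P = NP ⇒ the 0/1 permanent has polynomial-size circuits", equivalently — by
the landed U and Valiant1979 — "P = NP ⇒ P^{#P} = P"): any proof must be NON-RELATIVIZING (Ko1989 Thm 6.4:
`P^B = NP^B`, parity set outside `PH^B`, so `PP^B ⊄ P^B/poly`; Beigel–Maciel CCC 1999; Aaronson–Ingram–Kretschmer
2022 Thm 10/29), and no engine in print or in the tree derives EXISTENCE of permanent circuits from a uniform
collapse (STRATEGY-CENSUS.md: every transfer breaks at "PP ⊆ PH in Algorithmica" = the crux itself).
Disproof used: none exists for this crux (no Disproof.lean, 2026-08-17T12:50Z). Negatives honoured: nothing in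
`ledger negatives --problem PneNP` concerns the permanent's circuit size or collapse propagation above PH.
-/

set_option linter.dupNamespace false
set_option linter.unusedVariables false

namespace Summit.PneNP.PneNP.Cruxes.CollapseMakesPermanentEasy.Birth

open Literature.Computability.Complexity
open Summit.PneNP.PneNP.Theses.PermanentDescent

/-! ## §1 The one remaining registered stub -/

/-- **Stub 1 (the non-uniform core = route item stmt-PneNP-16144 `CollapseShrinksPermanent`, verbatim;
OPEN PROBLEM, size XL, LOAD-BEARING, held by the lead).** If `NP ⊆ P` then `PermBits ∈ P/poly`. Believed
vacuously true; an honest proof is a collapse propagation ABOVE the polynomial hierarchy and must be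
NON-RELATIVIZING (Ko1989 Thm 6.4: `P^B = NP^B ≠ PSPACE^B`, whence `PP^B ⊄ P^B/poly`).
[cite: Toda1991] [cite: KarpLipton1980] [cite: LFKN1992] [cite: Ko1989, Thm 6.4] -/
theorem stub_collapseShrinksPermanent :
    let PermBits : Language Bool := {w | ∃ (n : ℕ) (s : List Bool) (i : ℕ), s.length = n * n ∧ w = Literature.Computability.Complexity.boolPair s (Computability.encodeNat i) ∧ Nat.testBit (Matrix.permanent (Matrix.of fun a b : Fin n => if s.getD ((b : ℕ) + n * (a : ℕ)) false then (1 : ℕ) else 0)) i = true}; Literature.Computability.Complexity.Nondeterministic.NP ⊆ Literature.Computability.Complexity.Classes.P → PermBits ∈ Literature.Computability.Complexity.PPoly := by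
  sorry

/-! ## §2 Identifications (sorry-free, definitional) -/

/-- Stub 1's statement IS the route item `CollapseShrinksPermanent` (stmt-PneNP-16144). [folklore] -/
theorem shrinkSig_iff_item :
    (let PermBits : Language Bool := {w | ∃ (n : ℕ) (s : List Bool) (i : ℕ), s.length = n * n ∧ w = Literature.Computability.Complexity.boolPair s (Computability.encodeNat i) ∧ Nat.testBit (Matrix.permanent (Matrix.of fun a b : Fin n => if s.getD ((b : ℕ) + n * (a : ℕ)) false then (1 : ℕ) else 0)) i = true}; Literature.Computability.Complexity.Nondeterministic.NP ⊆ Literature.Computability.Complexity.Classes.P → PermBits ∈ Literature.Computability.Complexity.PPoly)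
      ↔ Summit.PneNP.PneNP.Theses.PermanentDescent.CollapseShrinksPermanent :=
  Iff.rfl

/-- **Direction record: Stub 1 is a CONSEQUENCE of the crux** (`P ⊆ P/poly`, `P_subset_PPoly_holds`), so with
the landed uniformization the crux and Stub 1 are EQUIVALENT. [cite: AroraBarakCC2009, Thm. 6.6] -/
theorem shrinkSig_of_crux
    (hK : Summit.PneNP.PneNP.Theses.PermanentDescent.CollapseMakesPermanentEasy) :
    Summit.PneNP.PneNP.Theses.PermanentDescent.CollapseShrinksPermanent :=
  fun h => P_subset_PPoly_holds (hK h)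

/-! ## §3 The composition (sorry-free modulo Stub 1) -/

/-- **THE SKELETON THEOREM.** The crux `Summit.PneNP.PneNP.Theses.PermanentDescent.CollapseMakesPermanentEasy`,
concluded BY NAME: under `h : NP ⊆ P`, Stub 1 gives `PermBits ∈ P/poly` and the LANDED uniformization theorem
`Summit.PneNP.PneNP.Theorems.uniformizationUnderCollapse_proof` (item stmt-PneNP-16145, closed) turns it into
`PermBits ∈ P`. [folklore] -/
theorem CollapseMakesPermanentEasy_of :
    Summit.PneNP.PneNP.Theses.PermanentDescent.CollapseMakesPermanentEasy := by
  have u := Summit.PneNP.PneNP.Theorems.uniformizationUnderCollapse_proof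
  unfold Summit.PneNP.PneNP.Theses.PermanentDescent.UniformizationUnderCollapse at u
  exact fun h => u h (stub_collapseShrinksPermanent h)

end Summit.PneNP.PneNP.Cruxes.CollapseMakesPermanentEasy.Birth
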